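import Summits.Ventures.PercRepro.C041BlockMapFourCores
import Summits.Ventures.PercRepro.C041BlockMapMultilinear
import Summits.Ventures.PercRepro.C041BlockMapClosure

/-!
# ROW C-041 — CONJECTURE (BLOCK MAP) IS DECIDED AT PURE INPUTS, FOR EVERY HOST; THE CONE FORM OF THE FOUR-VERTEX
CORES AS STATEMENTS OF RECORD (p6, gen 37; the successor item (2) of `C041BlockMapFourCores`)

`ConeHost Z u a` (CONJECTURE (BLOCK MAP) for one host, `C041BlockMapClosure`) asks that the block map send every
family of cone members into the cone.  Since the block map is multilinear and the cone is generated by the pure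
roots `V b` (`inCone_blockMap_of_pure`, `C041BlockMapMultilinear`), it is enough to test the families of pure
roots: **`coneHost_iff_pure`**.  For two exits indexed by `Bool` (`ex2 x y`) this is the statement over two
pure roots `V a`, `V b` (`coneHost_ex2_iff_pure`).  THE CORES of the four-vertex classification (`k4`, `d1`,
`d2`; `C041BlockMapFourCores`) have their block maps in closed form; this module names the closed forms
(`thetaK4`, `thetaD1`, `thetaD2`) and states CONJECTURE (BLOCK MAP) for each core in its cone form
(`coneHost_k4_iff` …) and in its pure form (`coneHost_k4_iff_pure` …) — the form the seed programme attacks for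
the triangle (`coneHost_tri_iff_pure`, `C041BlockMapTriangleBridge`).  No new mathematics: packaging only.
-/

namespace PercRepro

namespace ZoneZ

namespace MultiExit

open ZoneData Pendant Finset TwoExit TreeClosure

/-! ## CONJECTURE (BLOCK MAP) for a host is decided at pure inputs -/

section Pure

variable {ι V₁ E₁ U₁ U₂ : Type} (Z₁ : ZoneData V₁ E₁ U₁ U₂) (u : ι → V₁) (a₁ : V₁)
variable [Fintype ι] [DecidableEq ι] [Fintype E₁] [DecidableEq E₁]

/-- **CONJECTURE (BLOCK MAP) IS DECIDED AT PURE INPUTS**: a host is a cone host iff its block map sends every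
family of pure roots `V (b k)` into the cone. -/
theorem coneHost_iff_pure : ConeHost Z₁ u a₁ ↔ ∀ (m : ι → ℕ) (b : (k : ι) → Fin (m k) → ℝ),
    (∀ k i, 0 ≤ b k i ∧ b k i ≤ 1) → InCone (blockMap Z₁ u a₁ fun k => V (b k)) := by
  constructor
  · intro h m b hb
    exact h _ fun k => InCone.pure (b k) (hb k)
  · intro h
    exact inCone_blockMap_of_pure Z₁ u a₁ h

omit [DecidableEq ι] in
/-- A family indexed by `Bool` is the `if` of its two values. -/
theorem bool_family_eq (w : Bool → Vec6) : w = fun c => if c then w true else w false := by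
  funext c
  cases c <;> rfl

omit [DecidableEq ι] in
/-- The family `if c then Y else X` is a cone family when `X` and `Y` are cone members. -/
theorem inCone_bool_family {X Y : Vec6} (hX : InCone X) (hY : InCone Y) :
    ∀ c : Bool, InCone (if c then Y else X) := by
  intro c
  cases c
  · exact hX
  · exact hY

omit [Fintype ι] [DecidableEq ι] in
/-- **Two exits indexed by `Bool`**: the host with the exits `ex2 x y` (`false ↦ x`, `true ↦ y`) is a cone host
iff its block map at the pure roots `V a` (at `x`) and `V b` (at `y`) lies in the cone for all `a ∈ [0, 1]^m`,
`b ∈ [0, 1]^{m'}`. -/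
theorem coneHost_ex2_iff_pure (x y : V₁) :
    ConeHost Z₁ (ex2 x y) a₁ ↔ ∀ {m m' : ℕ} (a : Fin m → ℝ) (b : Fin m' → ℝ), (∀ i, 0 ≤ a i ∧ a i ≤ 1) →
      (∀ j, 0 ≤ b j ∧ b j ≤ 1) → InCone (blockMap Z₁ (ex2 x y) a₁ fun c => if c then V b else V a) := by
  constructor
  · intro h m m' a b ha hb
    exact h _ (inCone_bool_family (InCone.pure a ha) (InCone.pure b hb))
  · intro h
    rw [coneHost_iff_pure]
    intro m b hb
    rw [bool_family_eq fun k => V (b k)]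
    exact h (b false) (b true) (hb false) (hb true)

end Pure

/-! ## The closed forms of the cores -/

/-- The block map of `K₄` (`blockMap_k4`), as a function of the two inputs. -/
def thetaK4 (w w' : Vec6) : Vec6 :=
  (10 : Vec6) * (thB w * thB w') + (6 : Vec6) * (thB w * w') + (6 : Vec6) * thR (w * w') +
    (4 : Vec6) * (thR w * thR w') + (6 : Vec6) * (thR w * w') + (6 : Vec6) * (w * thB w') +
    (6 : Vec6) * (w * thR w') + (20 : Vec6) * (w * w')

/-- The block map of the diamond `K₄ − uu′` (`blockMap_d1`), as a function of the two inputs. -/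
def thetaD1 (w w' : Vec6) : Vec6 :=
  (5 : Vec6) * (thB w * thB w') + (2 : Vec6) * (thB w * thR w') + (4 : Vec6) * (thB w * w') +
    thR (w * w') + (2 : Vec6) * (thR w * thB w') + (4 : Vec6) * (thR w * thR w') +
    (4 : Vec6) * (thR w * w') + (4 : Vec6) * (w * thB w') + (4 : Vec6) * (w * thR w') +
    (2 : Vec6) * (w * w')

/-- The block map of the diamond `K₄ − au` (`blockMap_d2`), as a function of the two inputs. -/
def thetaD2 (w w' : Vec6) : Vec6 :=
  (8 : Vec6) * (thB w * thB w') + (4 : Vec6) * (thB w * w') + (2 : Vec6) * thR (thB w * w') +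
    (2 : Vec6) * (thR (thB w) * thB w') + (4 : Vec6) * thR (w * w') + (4 : Vec6) * (thR w * thR w') +
    (4 : Vec6) * (thR w * w') + w * thB w' + w * thR w' + (2 : Vec6) * (w * w')

/-- The block map of `K₄` is `thetaK4`. -/
theorem blockMap_k4_eq (w w' : Vec6) :
    blockMap k4 (ex2 1 2) 0 (fun b => if b then w' else w) = thetaK4 w w' :=
  blockMap_k4 w w'

/-- The block map of `K₄ − uu′` is `thetaD1`. -/
theorem blockMap_d1_eq (w w' : Vec6) :
    blockMap d1 (ex2 1 2) 0 (fun b => if b then w' else w) = thetaD1 w w' :=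
  blockMap_d1 w w'

/-- The block map of `K₄ − au` is `thetaD2`. -/
theorem blockMap_d2_eq (w w' : Vec6) :
    blockMap d2 (ex2 1 2) 0 (fun b => if b then w' else w) = thetaD2 w w' :=
  blockMap_d2 w w'

/-! ## The cone forms of the cores -/

/-- A two-exit host on `Fin 4` with the exits `ex2 1 2` whose block map is a given function `θ` of the two inputs
is a cone host iff `θ` sends pairs of cone members into the cone. -/
theorem coneHost_ex2_iff_of_eq {E : Type} [Fintype E] [DecidableEq E] (Z : ZoneData (Fin 4) E Empty Empty)
    (θ : Vec6 → Vec6 → Vec6) (hθ : ∀ w w', blockMap Z (ex2 1 2) 0 (fun b => if b then w' else w) = θ w w') :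
    ConeHost Z (ex2 1 2) 0 ↔ ∀ X Y : Vec6, InCone X → InCone Y → InCone (θ X Y) := by
  constructor
  · intro h X Y hX hY
    have := h _ (inCone_bool_family hX hY)
    rwa [hθ] at this
  · intro h w hw
    rw [bool_family_eq w, hθ]
    exact h _ _ (hw _) (hw _)

/-- The pure form of the same. -/
theorem coneHost_ex2_iff_pure_of_eq {E : Type} [Fintype E] [DecidableEq E] (Z : ZoneData (Fin 4) E Empty Empty)
    (θ : Vec6 → Vec6 → Vec6) (hθ : ∀ w w', blockMap Z (ex2 1 2) 0 (fun b => if b then w' else w) = θ w w') :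
    ConeHost Z (ex2 1 2) 0 ↔ ∀ {m m' : ℕ} (a : Fin m → ℝ) (b : Fin m' → ℝ), (∀ i, 0 ≤ a i ∧ a i ≤ 1) →
      (∀ j, 0 ≤ b j ∧ b j ≤ 1) → InCone (θ (V a) (V b)) := by
  rw [coneHost_ex2_iff_pure]
  simp only [hθ]

/-- **CONJECTURE (BLOCK MAP) FOR `K₄`, CONE FORM**: `K₄` with the exits `1`, `2` and the anchor `0` is a cone host
iff `thetaK4` sends pairs of cone members into the cone. -/
theorem coneHost_k4_iff : ConeHost k4 (ex2 1 2) 0 ↔ ∀ X Y : Vec6, InCone X → InCone Y → InCone (thetaK4 X Y) :=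
  coneHost_ex2_iff_of_eq k4 thetaK4 blockMap_k4_eq

/-- **CONJECTURE (BLOCK MAP) FOR `K₄`, PURE FORM** (the statement of record for the seed programme): `K₄` is a
cone host iff `thetaK4 (V a) (V b)` lies in the cone for all `a ∈ [0, 1]^m`, `b ∈ [0, 1]^{m'}`. -/
theorem coneHost_k4_iff_pure : ConeHost k4 (ex2 1 2) 0 ↔ ∀ {m m' : ℕ} (a : Fin m → ℝ) (b : Fin m' → ℝ),
    (∀ i, 0 ≤ a i ∧ a i ≤ 1) → (∀ j, 0 ≤ b j ∧ b j ≤ 1) → InCone (thetaK4 (V a) (V b)) :=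
  coneHost_ex2_iff_pure_of_eq k4 thetaK4 blockMap_k4_eq

/-- **CONJECTURE (BLOCK MAP) FOR `K₄ − uu′`, CONE FORM.** -/
theorem coneHost_d1_iff : ConeHost d1 (ex2 1 2) 0 ↔ ∀ X Y : Vec6, InCone X → InCone Y → InCone (thetaD1 X Y) :=
  coneHost_ex2_iff_of_eq d1 thetaD1 blockMap_d1_eq

/-- **CONJECTURE (BLOCK MAP) FOR `K₄ − uu′`, PURE FORM.** -/
theorem coneHost_d1_iff_pure : ConeHost d1 (ex2 1 2) 0 ↔ ∀ {m m' : ℕ} (a : Fin m → ℝ) (b : Fin m' → ℝ),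
    (∀ i, 0 ≤ a i ∧ a i ≤ 1) → (∀ j, 0 ≤ b j ∧ b j ≤ 1) → InCone (thetaD1 (V a) (V b)) :=
  coneHost_ex2_iff_pure_of_eq d1 thetaD1 blockMap_d1_eq

/-- **CONJECTURE (BLOCK MAP) FOR `K₄ − au`, CONE FORM.** -/
theorem coneHost_d2_iff : ConeHost d2 (ex2 1 2) 0 ↔ ∀ X Y : Vec6, InCone X → InCone Y → InCone (thetaD2 X Y) :=
  coneHost_ex2_iff_of_eq d2 thetaD2 blockMap_d2_eq

/-- **CONJECTURE (BLOCK MAP) FOR `K₄ − au`, PURE FORM.** -/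
theorem coneHost_d2_iff_pure : ConeHost d2 (ex2 1 2) 0 ↔ ∀ {m m' : ℕ} (a : Fin m → ℝ) (b : Fin m' → ℝ),
    (∀ i, 0 ≤ a i ∧ a i ≤ 1) → (∀ j, 0 ≤ b j ∧ b j ≤ 1) → InCone (thetaD2 (V a) (V b)) :=
  coneHost_ex2_iff_pure_of_eq d2 thetaD2 blockMap_d2_eq

end MultiExit

end ZoneZ

end PercRepro
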